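import Summits.Ventures.PercRepro.C025ProfileTopHallCoindep

/-!
# THE NULLITY PREDICATE UNDER DELETION, CONTRACTION AND LOOPS (night-3 g22)

A set `T` of a matroid `N` has NULLITY `≤ k` when it contains an independent set `I` with `|T ∖ I| ≤ k`
(`k = 0`: `T` independent; `k = 1`: `T` contains at most one circuit).  The four lemmas of this module move the
predicate `∃ I ⊆ T, N.Indep I ∧ |T ∖ I| ≤ k` through the steps of the deletion/contraction induction of the
companion module `C025ProfileTopHallNullity`:
* `nullity_le_erase` — erasing a point keeps nullity `≤ k`;
* `nullity_le_delete_iff` — for `e ∉ T`, nullity `≤ k` in `N ＼ e` is nullity `≤ k` in `N`;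
* `nullity_le_contract_iff` — for `e` not a loop and `e ∉ T`, nullity `≤ k` of `T` in `N ／ e` is nullity `≤ k`
  of `T ∪ e` in `N` (a basis of `T ∪ e` through `e` has at least as many points as any independent subset);
* `nullity_le_insert_loop_iff` — for a loop `e ∉ T`, `T ∪ e` has nullity `≤ k` iff `k ≥ 1` and `T` has nullity
  `≤ k − 1`.
No `def`, no `instance`, no notation.  Axioms: standard.
-/

open scoped Matroid

namespace PercRepro

open Set Finset ThmH

namespace TopHall

variable {α : Type} [DecidableEq α]

/-- Nullity `≤ k` passes to the set with a point erased. -/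
theorem nullity_le_erase {N : Matroid α} {k : ℕ} {B : Finset α} (e : α)
    (h : ∃ I ⊆ B, N.Indep (I : Set α) ∧ (B \ I).card ≤ k) :
    ∃ I ⊆ B.erase e, N.Indep (I : Set α) ∧ (B.erase e \ I).card ≤ k := by
  obtain ⟨I, hIB, hI, hk⟩ := h
  refine ⟨I.erase e, Finset.erase_subset_erase e hIB, hI.subset (by rw [Finset.coe_erase]; exact Set.sdiff_subset), ?_⟩
  refine le_trans (Finset.card_le_card ?_) hk
  intro x hx
  rw [Finset.mem_sdiff, Finset.mem_erase, Finset.mem_erase] at hx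
  rw [Finset.mem_sdiff]
  exact ⟨hx.1.2, fun hxI => hx.2 ⟨hx.1.1, hxI⟩⟩

/-- Nullity `≤ k` in `N ＼ e` for a set avoiding `e` is nullity `≤ k` in `N`. -/
theorem nullity_le_delete_iff {N : Matroid α} {k : ℕ} {T : Finset α} {e : α} (he : e ∉ T) :
    (∃ I ⊆ T, (N ＼ ({e} : Set α)).Indep (I : Set α) ∧ (T \ I).card ≤ k) ↔
      ∃ I ⊆ T, N.Indep (I : Set α) ∧ (T \ I).card ≤ k := by
  constructor
  · rintro ⟨I, hIT, hI, hk⟩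
    exact ⟨I, hIT, (Matroid.delete_indep_iff.1 hI).1, hk⟩
  · rintro ⟨I, hIT, hI, hk⟩
    refine ⟨I, hIT, ?_, hk⟩
    rw [Matroid.delete_indep_iff, Set.disjoint_singleton_right, Finset.mem_coe]
    exact ⟨hI, fun h => he (hIT h)⟩

/-- Nullity `≤ k` in `N ／ e` (`e` not a loop) for a set `T` avoiding `e` is nullity `≤ k` of `T ∪ e` in `N`. -/
theorem nullity_le_contract_iff {N : Matroid α} {k : ℕ} {T : Finset α} {e : α} (hloop : N.Indep ({e} : Set α))
    (he : e ∉ T) (hT : ((insert e T : Finset α) : Set α) ⊆ N.E) :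
    (∃ I ⊆ T, (N ／ ({e} : Set α)).Indep (I : Set α) ∧ (T \ I).card ≤ k) ↔
      ∃ I ⊆ insert e T, N.Indep (I : Set α) ∧ (insert e T \ I).card ≤ k := by
  constructor
  · rintro ⟨I, hIT, hI, hk⟩
    rw [hloop.contract_indep_iff, Set.disjoint_singleton_right, Finset.mem_coe, Set.union_singleton,
      ← Finset.coe_insert] at hI
    refine ⟨insert e I, Finset.insert_subset_insert e hIT, hI.2, ?_⟩
    refine le_trans (Finset.card_le_card ?_) hk
    intro x hx
    rw [Finset.mem_sdiff, Finset.mem_insert, Finset.mem_insert] at hx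
    rw [Finset.mem_sdiff]
    rcases hx.1 with rfl | hxT
    · exact absurd (Or.inl rfl) hx.2
    · exact ⟨hxT, fun hxI => hx.2 (Or.inr hxI)⟩
  · rintro ⟨J, hJT, hJ, hk⟩
    -- a basis of `T ∪ e` through `e` has at least `|J|` points
    obtain ⟨J', hJ'b, heJ'⟩ := hloop.subset_isBasis_of_subset
      (by rw [Set.singleton_subset_iff, Finset.mem_coe]; exact Finset.mem_insert_self e T) hT
    have hJ'fin : (J' : Set α).Finite := (Finset.finite_toSet _).subset hJ'b.subset
    obtain ⟨J'', hJ''⟩ := hJ'fin.exists_finset_coe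
    have hJ''T : J'' ⊆ insert e T := by rw [← Finset.coe_subset, hJ'']; exact hJ'b.subset
    have heJ'' : e ∈ J'' := by
      rw [← Finset.mem_coe, hJ'']
      exact heJ' (Set.mem_singleton e)
    have hJ''i : N.Indep (J'' : Set α) := by rw [hJ'']; exact hJ'b.indep
    have hcard : J.card ≤ J''.card := by
      have h1 : (J : Set α).encard ≤ N.eRk ((insert e T : Finset α) : Set α) :=
        hJ.encard_le_eRk_of_subset (by rw [Finset.coe_subset]; exact hJT)
      rw [← hJ'b.encard_eq_eRk, ← hJ'', Set.encard_coe_eq_coe_finsetCard, Set.encard_coe_eq_coe_finsetCard] at h1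
      exact_mod_cast h1
    refine ⟨J''.erase e, ?_, ?_, ?_⟩
    · intro x hx
      rw [Finset.mem_erase] at hx
      have := hJ''T hx.2
      rw [Finset.mem_insert] at this
      exact this.resolve_left hx.1
    · rw [hloop.contract_indep_iff, Set.disjoint_singleton_right, Finset.mem_coe, Set.union_singleton,
        ← Finset.coe_insert, Finset.insert_erase heJ'']
      exact ⟨Finset.notMem_erase e J'', hJ''i⟩
    · have h1 : T \ J''.erase e = insert e T \ J'' := by
        ext x
        rw [Finset.mem_sdiff, Finset.mem_sdiff, Finset.mem_erase, Finset.mem_insert]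
        constructor
        · rintro ⟨hxT, hx⟩
          refine ⟨Or.inr hxT, fun hxJ => hx ⟨fun hxe => he (hxe ▸ hxT), hxJ⟩⟩
        · rintro ⟨hx, hxJ⟩
          rcases hx with rfl | hxT
          · exact absurd heJ'' hxJ
          · exact ⟨hxT, fun h => hxJ h.2⟩
      rw [h1, Finset.card_sdiff_of_subset hJ''T]
      rw [Finset.card_sdiff_of_subset hJT] at hk
      omega

/-- For a loop `e ∉ T`: `T ∪ e` has nullity `≤ k` iff `k ≥ 1` and `T` has nullity `≤ k − 1`. -/
theorem nullity_le_insert_loop_iff {N : Matroid α} {k : ℕ} {T : Finset α} {e : α}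
    (hloop : ¬ N.Indep ({e} : Set α)) (he : e ∉ T) :
    (∃ I ⊆ insert e T, N.Indep (I : Set α) ∧ (insert e T \ I).card ≤ k) ↔
      (1 ≤ k ∧ ∃ I ⊆ T, N.Indep (I : Set α) ∧ (T \ I).card ≤ k - 1) := by
  constructor
  · rintro ⟨I, hIT, hI, hk⟩
    have heI : e ∉ I := by
      intro heI
      apply hloop
      apply hI.subset
      rw [Set.singleton_subset_iff, Finset.mem_coe]
      exact heI
    have hIT' : I ⊆ T := by
      intro x hx
      have := hIT hx
      rw [Finset.mem_insert] at this
      exact this.resolve_left (fun hxe => heI (hxe ▸ hx))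
    have h1 : insert e T \ I = insert e (T \ I) := by
      ext x
      rw [Finset.mem_sdiff, Finset.mem_insert, Finset.mem_insert, Finset.mem_sdiff]
      constructor
      · rintro ⟨hx, hxI⟩
        rcases hx with rfl | hxT
        · exact Or.inl rfl
        · exact Or.inr ⟨hxT, hxI⟩
      · rintro (rfl | ⟨hxT, hxI⟩)
        · exact ⟨Or.inl rfl, heI⟩
        · exact ⟨Or.inr hxT, hxI⟩
    have heTI : e ∉ T \ I := fun h => he (Finset.mem_sdiff.1 h).1
    rw [h1, Finset.card_insert_of_notMem heTI] at hk
    exact ⟨by omega, I, hIT', hI, by omega⟩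
  · rintro ⟨hk1, I, hIT, hI, hk⟩
    refine ⟨I, hIT.trans (Finset.subset_insert e T), hI, ?_⟩
    have heI : e ∉ I := fun h => he (hIT h)
    have h1 : insert e T \ I = insert e (T \ I) := by
      ext x
      rw [Finset.mem_sdiff, Finset.mem_insert, Finset.mem_insert, Finset.mem_sdiff]
      constructor
      · rintro ⟨hx, hxI⟩
        rcases hx with rfl | hxT
        · exact Or.inl rfl
        · exact Or.inr ⟨hxT, hxI⟩
      · rintro (rfl | ⟨hxT, hxI⟩)
        · exact ⟨Or.inl rfl, heI⟩
        · exact ⟨Or.inr hxT, hxI⟩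
    have heTI : e ∉ T \ I := fun h => he (Finset.mem_sdiff.1 h).1
    rw [h1, Finset.card_insert_of_notMem heTI]
    omega


end TopHall

end PercRepro
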